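import Mathlib
import Summits.NavierStokesRegularity.NavierStokesRegularity.Theorems.EulerZoomLiouvillePowerGaugeEulerLiouvilleWeakTraceTools
import Summits.NavierStokesRegularity.NavierStokesRegularity.Theorems.EulerZoomLiouvillePowerGaugeEulerLiouvilleTwoSidedMomentLaw
import HarnessLib

/-!
# THE WEAK TRACE LAW: the dilation family `V_λ = λ^{1+ρ}V(λ·)` of a budget-class profile converges against divergence-free test fields, with rate `λ^{−(2+ρ)}`
# (nsreg-p2 ROUND-54 «THE TRACE», plate t59-TR(a) = `NsregP2.R54.Trace.SolenoidalTraceLaw ρ V` VERBATIM, r54/Sketch54.lean f78682d2f4ee3f27 — text ADOPTED from this file;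
# seat ns-ezl-w3 g8, `--supports stmt-NavierStokesRegularity-19832 --as helper`)

For a `C²` self-similar Euler profile `(V, P)` with exponent `γ = 1/(2+ρ)`, centre `0`, and the `A`-gauge budget `∫_{B_R}‖V‖² ≤ A·R^{1−2ρ}` (`R ≥ 1`), and a
DIVERGENCE-FREE test field `φ ∈ C¹_c(ℝ³;ℝ³)`, the pairing `F(λ) = λ^{ρ−2}∫⟪V(y), φ(λ⁻¹y)⟫dy = ∫⟪λ^{1+ρ}V(λx), φ(x)⟫dx` has ONE scale derivative,
identified PRESSURE-FREE through the weak profile identity (`WeakTrace.weakProfileIdentity`, companion tools file) and bounded by the `A`-budget alone: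

* `WeakTrace.hasDerivAt_tracePairing` — `F′(λ) = (2+ρ)·λ^{ρ−4}·∫⟪V y, Dφ(λ⁻¹y)[V y]⟫dy` (`λ > 0`; the linear terms cancel EXACTLY because `(1 − 4γ)/γ = ρ − 2`:
  the self-similar degree is annihilated, SEEDS-R54 S4 at `k = 0`);
* ★ `WeakTrace.weakTraceLaw` — `|F′(λ)| ≤ (2+ρ)B₁A r^{1−2ρ}·λ^{−3−ρ}` is INTEGRABLE, so `∃ L C, ∀ λ ≥ 1, |F(λ) − L| ≤ C·λ^{−(2+ρ)}` (ns-sfl-p1 g9's measurability-free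
  `TwoSidedMoment.exists_limit_of_deriv_bound`): in the dictionary of SEEDS-R54 S2 (`u(τ,·) = V_λ` at `λ = (−τ)^{−γ}`) the blow-up-time trace `u(0⁻,·)` EXISTS
  weakly on divergence-free test fields, for EVERY `ρ > −2`, from the `A`-budget only;
* ★★ `WeakTrace.solenoidalTraceLaw (hρ : -2 < ρ) (V)` = `NsregP2.R54.Trace.SolenoidalTraceLaw ρ V` VERBATIM (plate t59-TR(a));
* `WeakTrace.integral_inner_dilation_eq` — the bridge to the `V_λ` currency: `∫⟪λ^{1+ρ}V(λx), φ x⟫dx = λ^{ρ−2}∫⟪V y, φ(λ⁻¹y)⟫dy`.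

HONEST FRAMING: a portrait instrument about HYPOTHETICAL profiles (the trace exists as a functional on div-free test fields; nothing is claimed about gradient parts or
about `L ≠ 0`); nothing about the crux E (`PowerGaugeEulerLiouville`, stmt 19832, OPEN) or NS regularity is proved; MODEL-lattice crux class; not E. [nsreg-p2 SEEDS-R54 S2/S3; folklore]
-/

noncomputable section

set_option linter.dupNamespace false

open MeasureTheory Set Filter Topology Metric Function TopologicalSpace
open scoped ENNReal NNReal RealInnerProductSpace Topology

namespace Summit.NavierStokesRegularity.NavierStokesRegularity.Theorems.PowerGaugeEulerLiouville

open Literature.Analysis Literature.Analysis.FluidPDE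

namespace WeakTrace

variable {Φ : EuclideanSpace ℝ (Fin 3) → EuclideanSpace ℝ (Fin 3)} {V : EuclideanSpace ℝ (Fin 3) → EuclideanSpace ℝ (Fin 3)}

/-! ## The scale derivative of the trace pairing and THE WEAK TRACE LAW -/

/-- Dilates of a compactly supported vector weight are compactly supported (`R ≠ 0`). [folklore] -/
theorem hasCompactSupport_dilate_vec (hΦc : HasCompactSupport Φ) {R : ℝ} (hR : R ≠ 0) :
    HasCompactSupport fun y : EuclideanSpace ℝ (Fin 3) => Φ (R⁻¹ • y) := by
  have h := hΦc.comp_homeomorph (Homeomorph.smulOfNeZero R⁻¹ (inv_ne_zero hR))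
  exact h

/-- The derivative of a dilated vector weight: `D(Φ(R⁻¹·))(y)[w] = DΦ(R⁻¹y)[R⁻¹w]`. [folklore] -/
theorem fderiv_dilate_vec_apply (hΦ : ContDiff ℝ 1 Φ) (R : ℝ) (y w : EuclideanSpace ℝ (Fin 3)) :
    fderiv ℝ (fun y : EuclideanSpace ℝ (Fin 3) => Φ (R⁻¹ • y)) y w = fderiv ℝ Φ (R⁻¹ • y) (R⁻¹ • w) := by
  have h1 : HasFDerivAt (fun y : EuclideanSpace ℝ (Fin 3) => R⁻¹ • y) (R⁻¹ • ContinuousLinearMap.id ℝ _) y :=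
    (hasFDerivAt_id y).const_smul R⁻¹
  have h2 : HasFDerivAt Φ (fderiv ℝ Φ (R⁻¹ • y)) (R⁻¹ • y) := (hΦ.differentiable one_ne_zero _).hasFDerivAt
  have h3 : HasFDerivAt (fun y : EuclideanSpace ℝ (Fin 3) => Φ (R⁻¹ • y))
      ((fderiv ℝ Φ (R⁻¹ • y)).comp (R⁻¹ • ContinuousLinearMap.id ℝ (EuclideanSpace ℝ (Fin 3)))) y := h2.comp y h1
  rw [h3.fderiv]
  simp

/-- The divergence of a dilated field: `div(Φ(R⁻¹·))(y) = R⁻¹·(div Φ)(R⁻¹y)`; in particular dilates of divergence-free fields are divergence-free. [folklore] -/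
theorem divergence_dilate_vec (hΦ : ContDiff ℝ 1 Φ) (R : ℝ) (y : EuclideanSpace ℝ (Fin 3)) :
    VectorCalculus.divergence (fun y : EuclideanSpace ℝ (Fin 3) => Φ (R⁻¹ • y)) y = R⁻¹ * VectorCalculus.divergence Φ (R⁻¹ • y) := by
  have h1 : HasFDerivAt (fun y : EuclideanSpace ℝ (Fin 3) => R⁻¹ • y) (R⁻¹ • ContinuousLinearMap.id ℝ _) y :=
    (hasFDerivAt_id y).const_smul R⁻¹
  have h2 : HasFDerivAt Φ (fderiv ℝ Φ (R⁻¹ • y)) (R⁻¹ • y) := (hΦ.differentiable one_ne_zero _).hasFDerivAt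
  have h3 : HasFDerivAt (fun y : EuclideanSpace ℝ (Fin 3) => Φ (R⁻¹ • y))
      ((fderiv ℝ Φ (R⁻¹ • y)).comp (R⁻¹ • ContinuousLinearMap.id ℝ (EuclideanSpace ℝ (Fin 3)))) y := h2.comp y h1
  unfold VectorCalculus.divergence
  rw [h3.fderiv, ContinuousLinearMap.comp_smul, ContinuousLinearMap.comp_id, ContinuousLinearMap.toLinearMap_smul, map_smul,
    smul_eq_mul]

variable {ρ : ℝ} {P : EuclideanSpace ℝ (Fin 3) → ℝ}

/-- **THE SCALE DERIVATIVE OF THE TRACE PAIRING** (`2 + ρ ≠ 0`): for a classical profile with exponent `γ = 1/(2+ρ)`, centre `0`, and a divergence-free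
test field `φ ∈ C¹_c`, the pairing `F(λ) = λ^{ρ−2}∫⟪V y, φ(λ⁻¹y)⟫dy` (`= ∫⟪λ^{1+ρ}V(λx), φ(x)⟫dx`) satisfies
`F′(λ) = (2+ρ)·λ^{ρ−4}·∫⟪V y, Dφ(λ⁻¹y)[V y]⟫dy` for `λ > 0`: the linear terms cancel EXACTLY because `(1 − 4γ)/γ = ρ − 2`
(the self-similar degree is annihilated), leaving only the quadratic term. [nsreg-p2 SEEDS-R54 S2/S4; folklore] -/
theorem hasDerivAt_tracePairing (hρ : 2 + ρ ≠ 0) (hprof : IsSelfSimilarEulerProfile (1 / (2 + ρ)) 0 V P)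
    {φ : EuclideanSpace ℝ (Fin 3) → EuclideanSpace ℝ (Fin 3)} (hφ : ContDiff ℝ 1 φ) (hφc : HasCompactSupport φ)
    (hdiv : ∀ y, VectorCalculus.divergence φ y = 0) {l : ℝ} (hl : 0 < l) :
    HasDerivAt (fun l : ℝ => l ^ (ρ - 2) * ∫ y, ⟪V y, φ (l⁻¹ • y)⟫)
      ((2 + ρ) * l ^ (ρ - 4) * ∫ y, ⟪V y, fderiv ℝ φ (l⁻¹ • y) (V y)⟫) l := by
  have hVc : Continuous V := hprof.contDiff_velocity.continuous
  set γ : ℝ := 1 / (2 + ρ) with hγdef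
  -- the three integrals at scale `l`
  set G : ℝ := ∫ y, ⟪V y, φ (l⁻¹ • y)⟫ with hGdef
  set H : ℝ := ∫ y, ⟪V y, fderiv ℝ φ (l⁻¹ • y) y⟫ with hHdef
  set K : ℝ := ∫ y, ⟪V y, fderiv ℝ φ (l⁻¹ • y) (V y)⟫ with hKdef
  -- `G′(l) = −l⁻² H`
  have hG := hasDerivAt_dilatedPairing hφ hφc hVc hl
  have hG' : ∫ y, ⟪V y, fderiv ℝ φ (l⁻¹ • y) ((-(l ^ 2)⁻¹) • y)⟫ = -(l ^ 2)⁻¹ * H := by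
    rw [hHdef, ← integral_const_mul]
    exact integral_congr_ae (ae_of_all _ fun y => by simp only [map_smul, real_inner_smul_right])
  rw [hG'] at hG
  -- the weak identity with `ψ = φ(l⁻¹·)`: `(1 − 4γ)G = l⁻¹(γH + K)`
  have hψ : ContDiff ℝ 1 (fun y : EuclideanSpace ℝ (Fin 3) => φ (l⁻¹ • y)) := hφ.comp (contDiff_const_smul l⁻¹)
  have hψc : HasCompactSupport (fun y : EuclideanSpace ℝ (Fin 3) => φ (l⁻¹ • y)) := hasCompactSupport_dilate_vec hφc hl.ne'
  have hψdiv : ∀ y, VectorCalculus.divergence (fun y : EuclideanSpace ℝ (Fin 3) => φ (l⁻¹ • y)) y = 0 := fun y => by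
    rw [divergence_dilate_vec hφ, hdiv, mul_zero]
  have hweak := weakProfileIdentity hprof hψ hψc hψdiv
  -- integrability of the two pieces (continuous × compact support of `Dφ(l⁻¹·)`)
  obtain ⟨B₀, B₁, r, hB₀, hB₁, hr, hφB, hDφB, hφ0, hDφ0⟩ := exists_bounds_of_vectorWeight hφ hφc
  have hDφc : Continuous (fderiv ℝ φ) := hφ.continuous_fderiv one_ne_zero
  have hsm : Continuous fun y : EuclideanSpace ℝ (Fin 3) => l⁻¹ • y := continuous_const_smul l⁻¹
  have hsuppD : ∀ {w : EuclideanSpace ℝ (Fin 3) → EuclideanSpace ℝ (Fin 3)}, Continuous w →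
      Integrable (fun y => ⟪V y, fderiv ℝ φ (l⁻¹ • y) (w y)⟫) := by
    intro w hw
    refine ((hVc.inner ((hDφc.comp hsm).clm_apply hw)).integrable_of_hasCompactSupport ?_)
    refine HasCompactSupport.of_support_subset_isCompact (isCompact_closedBall (0 : EuclideanSpace ℝ (Fin 3)) (r * l)) fun y hy => ?_
    rw [mem_closedBall, dist_zero_right]
    by_contra hcon
    have hfar : r ≤ ‖l⁻¹ • y‖ := by
      rw [norm_smul, norm_inv, Real.norm_eq_abs, abs_of_pos hl, le_inv_mul_iff₀ hl]
      linarith [not_le.1 hcon]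
    exact hy (by simp only [hDφ0 _ hfar, zero_apply, inner_zero_right])
  have hIH : Integrable (fun y => ⟪V y, fderiv ℝ φ (l⁻¹ • y) y⟫) := hsuppD continuous_id
  have hIK : Integrable (fun y => ⟪V y, fderiv ℝ φ (l⁻¹ • y) (V y)⟫) := hsuppD hVc
  have hrhs : ∫ y, ⟪V y, fderiv ℝ (fun y : EuclideanSpace ℝ (Fin 3) => φ (l⁻¹ • y)) y (γ • y + V y)⟫ = l⁻¹ * (γ * H + K) := by
    have e : ∀ y, ⟪V y, fderiv ℝ (fun y : EuclideanSpace ℝ (Fin 3) => φ (l⁻¹ • y)) y (γ • y + V y)⟫ =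
        l⁻¹ * γ * ⟪V y, fderiv ℝ φ (l⁻¹ • y) y⟫ + l⁻¹ * ⟪V y, fderiv ℝ φ (l⁻¹ • y) (V y)⟫ := by
      intro y
      rw [fderiv_dilate_vec_apply hφ]
      simp only [smul_add, map_add, map_smul, smul_smul, inner_add_right, real_inner_smul_right]
    simp_rw [e]
    rw [integral_add (hIH.const_mul _) (hIK.const_mul _), integral_const_mul, integral_const_mul]
    ring
  rw [hrhs] at hweak
  -- the product rule and the cancellation `(1 − 4γ)/γ = ρ − 2`
  have hpow : HasDerivAt (fun l : ℝ => l ^ (ρ - 2)) ((ρ - 2) * l ^ (ρ - 2 - 1)) l :=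
    Real.hasDerivAt_rpow_const (Or.inl hl.ne')
  have hF := hpow.mul hG
  refine hF.congr_deriv ?_
  have hγ : γ * (2 + ρ) = 1 := by rw [hγdef]; field_simp
  have hHsol : H = (2 + ρ) * (l * (1 - 4 * γ) * G - K) := by
    have h1 : (1 - 4 * γ) * G = l⁻¹ * (γ * H + K) := hweak
    have hl0 : l ≠ 0 := hl.ne'
    have h2 : γ * H + K = l * ((1 - 4 * γ) * G) := by
      rw [h1, ← mul_assoc, mul_inv_cancel₀ hl0, one_mul]
    have h3 : γ * H = l * (1 - 4 * γ) * G - K := by linarith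
    calc H = (2 + ρ) * (γ * H) := by rw [← mul_assoc, mul_comm (2 + ρ) γ, hγ, one_mul]
      _ = (2 + ρ) * (l * (1 - 4 * γ) * G - K) := by rw [h3]
  have e3 : l ^ (ρ - 2 - 1) = l ^ (ρ - 4) * l := by
    rw [show ρ - 2 - 1 = (ρ - 4) + 1 by ring, Real.rpow_add hl, Real.rpow_one]
  have e2 : l ^ (ρ - 2) = l ^ (ρ - 4) * l ^ 2 := by
    rw [show ρ - 2 = (ρ - 4) + 2 by ring, Real.rpow_add hl, Real.rpow_two]
  have hl0 : l ≠ 0 := hl.ne'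
  have e4 : l ^ (ρ - 2) * (-(l ^ 2)⁻¹ * H) = -(l ^ (ρ - 4) * H) := by
    rw [e2]; field_simp
  have h14 : 1 - 4 * γ = γ * (ρ - 2) := by
    have : γ = 1 / (2 + ρ) := hγdef
    rw [this]; field_simp; ring
  rw [e3, e4, hHsol, h14]
  linear_combination (-(ρ - 2) * l * l ^ (ρ - 4) * G) * hγ

/-- ★ **THE WEAK TRACE LAW** (`ρ > −2`; plate t59-TR of nsreg-p2 ROUND-54): for a `C²` self-similar Euler profile with exponent `γ = 1/(2+ρ)`, centre `0`, and the
`A`-gauge budget `∫_{B_R}‖V‖² ≤ A·R^{1−2ρ}` (`R ≥ 1`), and every divergence-free test field `φ ∈ C¹_c(ℝ³;ℝ³)`, the dilation pairing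
`F(λ) = λ^{ρ−2}∫⟪V y, φ(λ⁻¹y)⟫dy = ∫⟪λ^{1+ρ}V(λx), φ(x)⟫dx` CONVERGES as `λ → ∞`, with the rate `|F(λ) − F_∞| ≤ C·λ^{−(2+ρ)}` for `λ ≥ 1`
(`|F′(λ)| ≤ (2+ρ)B₁A r^{1−2ρ}·λ^{−3−ρ}` by `hasDerivAt_tracePairing` and the budget; then `TwoSidedMoment.exists_limit_of_deriv_bound`). In the dictionary of
SEEDS-R54 S2 (`u(τ,·) = V_λ` at `λ = (−τ)^{−γ}`): the blow-up-time trace `u(0⁻,·)` EXISTS weakly on divergence-free test fields. [nsreg-p2 SEEDS-R54 S2/S3; folklore] -/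
theorem weakTraceLaw (hρ : -2 < ρ) (hprof : IsSelfSimilarEulerProfile (1 / (2 + ρ)) 0 V P)
    (hA : ∃ A : ℝ, ∀ R : ℝ, 1 ≤ R → ∫ y in ball (0 : EuclideanSpace ℝ (Fin 3)) R, ‖V y‖ ^ 2 ≤ A * R ^ (1 - 2 * ρ))
    {φ : EuclideanSpace ℝ (Fin 3) → EuclideanSpace ℝ (Fin 3)} (hφ : ContDiff ℝ 1 φ) (hφc : HasCompactSupport φ)
    (hdiv : ∀ y, VectorCalculus.divergence φ y = 0) :
    ∃ L C : ℝ, ∀ l : ℝ, 1 ≤ l → |l ^ (ρ - 2) * (∫ y, ⟪V y, φ (l⁻¹ • y)⟫) - L| ≤ C * l ^ (-(2 + ρ)) := by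
  have h2ρ : 0 < 2 + ρ := by linarith
  have hVc : Continuous V := hprof.contDiff_velocity.continuous
  obtain ⟨B₀, B₁, r, hB₀, hB₁, hr, hφB, hDφB, hφ0, hDφ0⟩ := exists_bounds_of_vectorWeight hφ hφc
  obtain ⟨A, hA⟩ := hA
  set A' : ℝ := max A 0 with hA'def
  have hA'0 : 0 ≤ A' := le_max_right _ _
  set r' : ℝ := max r 1 with hr'def
  have hr'1 : 1 ≤ r' := le_max_right _ _
  have hr'0 : 0 < r' := by linarith
  have hDφ0' : ∀ x, r' ≤ ‖x‖ → fderiv ℝ φ x = 0 := fun x hx => hDφ0 x (le_trans (le_max_left _ _) hx)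
  -- the bound on the quadratic integral: `|∫⟪V, Dφ(l⁻¹y)[V]⟫| ≤ B₁ ∫_{B(0, r'l)} ‖V‖² ≤ B₁ A' (r'l)^{1−2ρ}`
  have hK : ∀ l : ℝ, 1 ≤ l → |∫ y, ⟪V y, fderiv ℝ φ (l⁻¹ • y) (V y)⟫| ≤ B₁ * (A' * (r' * l) ^ (1 - 2 * ρ)) := by
    intro l hl
    have hl0 : 0 < l := by linarith
    have hint2 : IntegrableOn (fun y => ‖V y‖ ^ 2) (ball (0 : EuclideanSpace ℝ (Fin 3)) (r' * l)) :=
      ((hVc.norm.pow 2).continuousOn.integrableOn_compact (isCompact_closedBall (0 : EuclideanSpace ℝ (Fin 3)) (r' * l))).mono_set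
        ball_subset_closedBall
    have hind : ∀ y, ‖⟪V y, fderiv ℝ φ (l⁻¹ • y) (V y)⟫‖ ≤
        (ball (0 : EuclideanSpace ℝ (Fin 3)) (r' * l)).indicator (fun y => B₁ * ‖V y‖ ^ 2) y := by
      intro y
      by_cases hy : y ∈ ball (0 : EuclideanSpace ℝ (Fin 3)) (r' * l)
      · rw [indicator_of_mem hy]
        calc ‖⟪V y, fderiv ℝ φ (l⁻¹ • y) (V y)⟫‖ ≤ ‖V y‖ * ‖fderiv ℝ φ (l⁻¹ • y) (V y)‖ := norm_inner_le_norm _ _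
          _ ≤ ‖V y‖ * (B₁ * ‖V y‖) := mul_le_mul_of_nonneg_left
              (((fderiv ℝ φ (l⁻¹ • y)).le_opNorm _).trans (mul_le_mul_of_nonneg_right (hDφB _) (norm_nonneg _))) (norm_nonneg _)
          _ = B₁ * ‖V y‖ ^ 2 := by ring
      · rw [indicator_of_notMem hy]
        rw [mem_ball_zero_iff, not_lt] at hy
        have hfar : r' ≤ ‖l⁻¹ • y‖ := by
          rw [norm_smul, norm_inv, Real.norm_eq_abs, abs_of_pos hl0, le_inv_mul_iff₀ hl0]; linarith
        rw [hDφ0' _ hfar, zero_apply, inner_zero_right, norm_zero]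
    calc |∫ y, ⟪V y, fderiv ℝ φ (l⁻¹ • y) (V y)⟫| = ‖∫ y, ⟪V y, fderiv ℝ φ (l⁻¹ • y) (V y)⟫‖ := (Real.norm_eq_abs _).symm
      _ ≤ ∫ y, (ball (0 : EuclideanSpace ℝ (Fin 3)) (r' * l)).indicator (fun y => B₁ * ‖V y‖ ^ 2) y :=
          norm_integral_le_of_norm_le ((integrable_indicator_iff measurableSet_ball).2 (hint2.const_mul B₁)) (ae_of_all _ hind)
      _ = B₁ * ∫ y in ball (0 : EuclideanSpace ℝ (Fin 3)) (r' * l), ‖V y‖ ^ 2 := by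
          rw [integral_indicator measurableSet_ball, integral_const_mul]
      _ ≤ B₁ * (A' * (r' * l) ^ (1 - 2 * ρ)) := by
          refine mul_le_mul_of_nonneg_left ?_ hB₁
          have hrl : 1 ≤ r' * l := by nlinarith
          exact (hA (r' * l) hrl).trans (mul_le_mul_of_nonneg_right (le_max_left _ _) (Real.rpow_nonneg (by positivity) _))
  -- the derivative bound `|F′(l)| ≤ K₀ l^{−1−(2+ρ)}` for `l ≥ 1`
  set K₀ : ℝ := (2 + ρ) * B₁ * A' * r' ^ (1 - 2 * ρ) with hK₀def
  have hK₀ : 0 ≤ K₀ := by positivity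
  have hderiv : ∀ l : ℝ, 0 < l → HasDerivAt (fun l : ℝ => l ^ (ρ - 2) * ∫ y, ⟪V y, φ (l⁻¹ • y)⟫)
      ((2 + ρ) * l ^ (ρ - 4) * ∫ y, ⟪V y, fderiv ℝ φ (l⁻¹ • y) (V y)⟫) l :=
    fun l hl => hasDerivAt_tracePairing h2ρ.ne' hprof hφ hφc hdiv hl
  have hbd : ∀ l : ℝ, 1 ≤ l → |(2 + ρ) * l ^ (ρ - 4) * ∫ y, ⟪V y, fderiv ℝ φ (l⁻¹ • y) (V y)⟫| ≤ K₀ * l ^ (-1 - (2 + ρ)) := by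
    intro l hl
    have hl0 : 0 < l := by linarith
    rw [abs_mul, abs_mul, abs_of_pos h2ρ, abs_of_pos (Real.rpow_pos_of_pos hl0 _)]
    calc (2 + ρ) * l ^ (ρ - 4) * |∫ y, ⟪V y, fderiv ℝ φ (l⁻¹ • y) (V y)⟫|
        ≤ (2 + ρ) * l ^ (ρ - 4) * (B₁ * (A' * (r' * l) ^ (1 - 2 * ρ))) :=
          mul_le_mul_of_nonneg_left (hK l hl) (by positivity)
      _ = K₀ * l ^ (-1 - (2 + ρ)) := by
          rw [hK₀def, Real.mul_rpow hr'0.le hl0.le]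
          have e : l ^ (ρ - 4) * l ^ (1 - 2 * ρ) = l ^ (-1 - (2 + ρ)) := by
            rw [← Real.rpow_add hl0]; congr 1; ring
          calc (2 + ρ) * l ^ (ρ - 4) * (B₁ * (A' * (r' ^ (1 - 2 * ρ) * l ^ (1 - 2 * ρ))))
              = (2 + ρ) * B₁ * A' * r' ^ (1 - 2 * ρ) * (l ^ (ρ - 4) * l ^ (1 - 2 * ρ)) := by ring
            _ = (2 + ρ) * B₁ * A' * r' ^ (1 - 2 * ρ) * l ^ (-1 - (2 + ρ)) := by rw [e]
  obtain ⟨L, hL⟩ := TwoSidedMoment.exists_limit_of_deriv_bound h2ρ hK₀ hderiv hbd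
  exact ⟨L, K₀ / (2 + ρ), fun l hl => hL l hl⟩

/-- **The two forms of the trace pairing** (`λ > 0`): `∫⟪λ^{1+ρ}V(λx), φ(x)⟫dx = λ^{ρ−2}·∫⟪V y, φ(λ⁻¹y)⟫dy` (substitution `y = λx`, Jacobian `λ³`:
Mathlib `Measure.integral_comp_inv_smul_of_nonneg`). [folklore] -/
theorem integral_inner_dilation_eq (V φ : EuclideanSpace ℝ (Fin 3) → EuclideanSpace ℝ (Fin 3)) (ρ : ℝ) {l : ℝ} (hl : 0 < l) :
    ∫ x, ⟪(l ^ (1 + ρ)) • V (l • x), φ x⟫ = l ^ (ρ - 2) * ∫ y, ⟪V y, φ (l⁻¹ • y)⟫ := by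
  have h := Measure.integral_comp_inv_smul_of_nonneg (μ := (volume : Measure (EuclideanSpace ℝ (Fin 3))))
    (fun y : EuclideanSpace ℝ (Fin 3) => ⟪V y, φ (l⁻¹ • y)⟫) (inv_nonneg.2 hl.le)
  -- `h : ∫ x, ⟪V (l⁻¹⁻¹ • x), φ (l⁻¹ • (l⁻¹⁻¹ • x))⟫ = (l⁻¹)³ • ∫ y, ⟪V y, φ (l⁻¹ • y)⟫`
  have e : (fun x : EuclideanSpace ℝ (Fin 3) => ⟪V (l⁻¹⁻¹ • x), φ (l⁻¹ • (l⁻¹⁻¹ • x))⟫) =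
      fun x => ⟪V (l • x), φ x⟫ := by
    funext x
    rw [inv_inv, smul_smul, inv_mul_cancel₀ hl.ne', one_smul]
  rw [e, finrank_euclideanSpace_fin, smul_eq_mul] at h
  have e2 : ∫ x, ⟪(l ^ (1 + ρ)) • V (l • x), φ x⟫ = l ^ (1 + ρ) * ∫ x, ⟪V (l • x), φ x⟫ := by
    rw [← integral_const_mul]
    exact integral_congr_ae (ae_of_all _ fun x => by simp only [real_inner_smul_left])
  rw [e2, h, ← mul_assoc]
  congr 1
  rw [inv_pow, ← Real.rpow_natCast l 3, ← Real.rpow_neg hl.le, ← Real.rpow_add hl]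
  congr 1; push_cast; ring

/-- ★★ **t59-TR(a): `NsregP2.R54.Trace.SolenoidalTraceLaw ρ V` VERBATIM** (r54/Sketch54.lean f78682d2f4ee3f27; the text was adopted from `weakTraceLaw`), for every `ρ > −2`:
the scaled pairing of a budget-class `C²` profile against every divergence-free `C¹_c` test field converges with rate `l^{−(2+ρ)}`. [nsreg-p2 R54 §B; folklore] -/
theorem solenoidalTraceLaw {ρ : ℝ} (hρ : -2 < ρ) (V : EuclideanSpace ℝ (Fin 3) → EuclideanSpace ℝ (Fin 3)) :
    ∀ P : EuclideanSpace ℝ (Fin 3) → ℝ, IsSelfSimilarEulerProfile (1 / (2 + ρ)) 0 V P →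
      (∃ A : ℝ, ∀ R : ℝ, 1 ≤ R → ∫ y in ball (0 : EuclideanSpace ℝ (Fin 3)) R, ‖V y‖ ^ 2 ≤ A * R ^ (1 - 2 * ρ)) →
      ∀ φ : EuclideanSpace ℝ (Fin 3) → EuclideanSpace ℝ (Fin 3), ContDiff ℝ 1 φ → HasCompactSupport φ →
        (∀ y, VectorCalculus.divergence φ y = 0) →
        ∃ L C : ℝ, ∀ l : ℝ, 1 ≤ l → |l ^ (ρ - 2) * (∫ y, ⟪V y, φ (l⁻¹ • y)⟫) - L| ≤ C * l ^ (-(2 + ρ)) :=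
  fun _ hprof hA _ hφ hφc hdiv => weakTraceLaw hρ hprof hA hφ hφc hdiv

end WeakTrace

end Summit.NavierStokesRegularity.NavierStokesRegularity.Theorems.PowerGaugeEulerLiouville

end
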